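import Summits.ABC.IUTFork.Joshi.ArithmeticoidCollationReadings
import Mathlib.Topology.Homeomorph.Lemmas
import Mathlib.Topology.Algebra.Monoid

/-!
# [J-II½] Prop. 7.5.1, reading W: the collation of a single class already contains its prime-to-`p` POWERS
# (proof-only companion of `Joshi/ArithmeticoidCollation.lean` / `…Readings.lean`; no new claim)

Proof-only file of the abc-iut cell, branch E (rung LADDER-ABC:A2.E; seat abc-iut-E-t38); no frozen import (E-PLAN R14). SOURCE and
locators as in `Joshi/ArithmeticoidCollation.lean` (K. Joshi, arXiv:2305.10398v12, UNREFEREED; bib `Joshi2023ATS2half`). **No side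
is taken** on [IUTchIII] Cor. 3.12, on Joshi's claims, or on Mochizuki's report on them; typed ≠ proved; what follows is a
LOCATION in standard mathematics, not a verdict on any author.

WHAT IS PROVED (over the carriers of `Joshi/ArithmeticoidCohomology.lean`: places `V`, points `Pt v`, cohomology factors
`H i v y_v` — commutative topological groups —, a `CohomologyDatum 𝔠` with its standard arithmeticoid `y₀ = 𝔠.std`). Recall the two
readings of «under all the isomorphisms (of topological groups) of each factor of H^1(arith(L)_y, ℤ(1)) ≃ H^1(arith(L)_{y₀}, ℤ(1))
provided by Proposition 7.4.1» ([J-II½] Prop. 7.5.1, p.49 l.8–11): W = `allTopIsos` (every topological-group isomorphism of the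
factor), N = `providedIsos` (those induced by anabelomorphisms, [J-I] Thm. 8.4.1). Here, for reading W:
* `powEquivOfBijective_mem_allTopIsos`: on a factor that is a compact Hausdorff topological monoid under multiplication, every
  BIJECTIVE power map `x ↦ x^u` is a W-isomorphism of the factor with itself (continuity of `x ↦ x^u`; the inverse of a continuous
  bijection from a compact space to a Hausdorff space is continuous);
* `pow_mem_collationAll`: consequently, if the standard arithmeticoid `y₀` belongs to the collection `A` and `c ∈ Ψ_{y₀}`, then the
  W-collation `Ψ_{X,A}` contains the factorwise power `(c_v^{u_v})_v` for ANY family of exponents `u_v` whose power maps are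
  bijective on the standard factors.
WHY IT MATTERS (dictionary row D-10 «collation isomorphisms ↦ ⟨(Ind1) ∪ (Ind2)⟩»; consumers E-t18 `DictionaryCollation`
(`CollationInIsm` / `CollationInStripAut`), E-t22, E-cx; located, NOT adjudicated). By [J-II½] Prop. 7.2.2 (2) (`NonarcKummer`,
typed in `Joshi/ArithmeticoidCohomology.lean`) the non-archimedean factor is `H^1(G_{L_v}, ℤ_{p_v}(1)) ≃ lim_n L_v^×/L_v^{×p_v^n}`, a
compact Hausdorff abelian pro-`p_v` group, on which `x ↦ x^u` IS bijective for every `u` prime to `p_v` (standard; it enters below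
only as the hypothesis `hu`, nothing about `ℤ_p` is asserted here). So, READ LITERALLY (W), Joshi's collation of the single Kummer
class of `q_v` at the standard arithmeticoid already contains the classes of `q_v^u` for all `u` prime to `p_v` — in particular of
`q_v^{j²}` whenever `p_v ∤ j` — i.e. under W «the powers `q^{j²}` are collation-translates of `q`» holds at the level of Kummer
classes for bookkeeping reasons alone, while under N only Galois-induced isomorphisms are available (which, being induced by
field isomorphisms, do not raise a uniformizer's class to a non-trivial power — not formalised here). Which reading print
intends is E-ref's question; what OUR `Ind1Family` / `Ind2Family` contain is E-cx's (E-PLAN §2). Standard axioms only;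
sorry-free. [claim: Joshi2023ATS2half, status: disputed]
-/

set_option autoImplicit false

noncomputable section

open Set

namespace Summit.ABC.IUTFork.Joshi.ATS2half

universe u

section PowerMoves

variable {V : Type u} {Pt : V → Type u} (H : ℕ → (v : V) → Pt v → Type u) [∀ i v y, CommGroup (H i v y)]

/-- The `u`-th power map of a factor, as a self-bijection when it is bijective. [folklore] -/
def powEquivOfBijective (i : ℕ) (v : V) (a : Pt v) (u : ℕ) (hu : Function.Bijective fun x : H i v a => x ^ u) :
    H i v a ≃ H i v a :=
  Equiv.ofBijective _ hu

/-- `powEquivOfBijective` is `x ↦ x^u`. [folklore] -/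
@[simp] theorem powEquivOfBijective_apply (i : ℕ) (v : V) (a : Pt v) (u : ℕ)
    (hu : Function.Bijective fun x : H i v a => x ^ u) (x : H i v a) : powEquivOfBijective H i v a u hu x = x ^ u := rfl

variable [∀ i v y, TopologicalSpace (H i v y)]

/-- **A bijective power map of a compact Hausdorff topological-monoid factor is a W-isomorphism** (reading W = `allTopIsos`:
«all the isomorphisms (of topological groups) of each factor», [J-II½] Prop. 7.5.1 p.49 l.8–10): `x ↦ x^u` is continuous and
multiplicative, and a continuous bijection from a compact space to a Hausdorff space has continuous inverse. [folklore] -/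
theorem powEquivOfBijective_mem_allTopIsos (i : ℕ) (v : V) (a : Pt v) (u : ℕ) [ContinuousMul (H i v a)]
    [CompactSpace (H i v a)] [T2Space (H i v a)] (hu : Function.Bijective fun x : H i v a => x ^ u) :
    powEquivOfBijective H i v a u hu ∈ allTopIsos H i v a a := by
  have hc : Continuous (powEquivOfBijective H i v a u hu) := continuous_pow u
  refine ⟨hc, ?_, fun x x' => mul_pow x x' u⟩
  exact (hc.homeoOfEquivCompactToT2 (f := powEquivOfBijective H i v a u hu)).continuous_symm

variable {H}
variable {IsArc : Set V} {G : (v : V) → Pt v → Type u} [∀ v y, Group (G v y)] [∀ v y, TopologicalSpace (G v y)]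

/-- **Under reading W the collation of a class contains all its factorwise bijective powers**: if the standard arithmeticoid
`y₀` lies in the collection `A` and `c ∈ Ψ_{y₀}`, then `(c_v^{u_v})_v ∈ Ψ_{X,A}` (W-collation) for every family of exponents `u_v`
with bijective power maps on the (compact Hausdorff topological-monoid) standard factors — e.g. `u_v` prime to `p_v` on
`H^1(G_{L_v}, ℤ_{p_v}(1)) ≃ lim_n L_v^×/L_v^{×p_v^n}` ([J-II½] Prop. 7.2.2 (2)). [folklore] -/
theorem pow_mem_collationAll (𝔠 : CohomologyDatum H IsArc G) (i : ℕ) {A : Set (∀ v, Pt v)}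
    {Ψ : ∀ y : (∀ v, Pt v), Set (CohArith H i y)} (hstd : 𝔠.std ∈ A) {c : CohArith H i 𝔠.std} (hc : c ∈ Ψ 𝔠.std)
    (u : V → ℕ) [∀ v, ContinuousMul (H i v (𝔠.std v))] [∀ v, CompactSpace (H i v (𝔠.std v))]
    [∀ v, T2Space (H i v (𝔠.std v))] (hu : ∀ v, Function.Bijective fun x : H i v (𝔠.std v) => x ^ u v) :
    (fun v => c v ^ u v) ∈ 𝔠.collationAll i A Ψ := by
  have h := collationAll_translate_subset 𝔠 i A Ψ (fun v => powEquivOfBijective H i v (𝔠.std v) (u v) (hu v))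
    (fun v => powEquivOfBijective_mem_allTopIsos H i v (𝔠.std v) (u v) (hu v))
  exact h ⟨c, 𝔠.subset_collationAll i Ψ hstd hc, rfl⟩

/-- The same for a single exponent `u` at every place (e.g. `u = j²`): the W-collation of the class of `q` contains the class of
`q^u` as soon as the `u`-th power maps of the standard factors are bijective. [folklore] -/
theorem pow_mem_collationAll_const (𝔠 : CohomologyDatum H IsArc G) (i : ℕ) {A : Set (∀ v, Pt v)}
    {Ψ : ∀ y : (∀ v, Pt v), Set (CohArith H i y)} (hstd : 𝔠.std ∈ A) {c : CohArith H i 𝔠.std} (hc : c ∈ Ψ 𝔠.std) (u : ℕ)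
    [∀ v, ContinuousMul (H i v (𝔠.std v))] [∀ v, CompactSpace (H i v (𝔠.std v))] [∀ v, T2Space (H i v (𝔠.std v))]
    (hu : ∀ v, Function.Bijective fun x : H i v (𝔠.std v) => x ^ u) :
    c ^ u ∈ 𝔠.collationAll i A Ψ :=
  pow_mem_collationAll 𝔠 i hstd hc (fun _ => u) hu

end PowerMoves

end Summit.ABC.IUTFork.Joshi.ATS2half

end
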